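import Summits.CriticalPhenomena.SAWScalingLimit.Theorems.HexTight.Negative.RingDomain

/-!
# Ring counterexamples for crux `HexTight` (stmt-CriticalPhenomena-5423), part 7:
verbatim statements of `differentiated-sum-rule` §C; weights of `Ω_1`; index bookkeeping

VERBATIM copies (sub-namespace `DSR`, bodies token-for-token those of
`Summit.CriticalPhenomena.SAWScalingLimit.Cruxes.HexTight.DifferentiatedSumRule` in
`Cruxes/HexTight/Lines/differentiated-sum-rule.lean`, 2026-08-16): `pos`, `slitSet`, `annVerts`,
`IsAnnulusComponent`, `Unforced`, `InnerTouchesBoundary`, `FutureCrossesIn`, `FutureCrossesOut`,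
`PinnedReturnBound` (conclusion of the registered stub `stub_pinnedReturn_of`), `OutwardDiveBound`
(statement of the registered unconditional stub `stub_outwardDive`). Plus plumbing for the refutations
in `Negative/OutwardDiveFalse.lean`: transfer of lattice walks to `Ω_1` with the same support, the weight
of a set of SAWs as a finite sum of `x_c^{ℓ(γ)}` (`weight_apply`), lifting walks to an induced subgraph,
indices of a list decomposition.
-/

noncomputable section

open scoped BigOperators
open Classical
open Literature.Probability.LatticeModels
open Literature.Probability.RandomPlanarGeometry.SAW

namespace Summit.CriticalPhenomena.SAWScalingLimit.Cruxes.HexTight.Negative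

/-! ## Part 7 — Verbatim copies (`Cruxes/HexTight/Lines/differentiated-sum-rule.lean` §C, 2026-08-16)

Placed in the sub-namespace `DSR` (their `annVerts` would clash with the tip-renewal copy above);
the bodies are token-for-token those of `Summit.…Cruxes.HexTight.DifferentiatedSumRule`. -/

namespace DSR

open MeasureTheory Filter Topology Set Metric
open Literature.Probability.RandomPlanarGeometry

/-- position of a face at mesh `δ` -/
def pos (δ : ℝ) (y : HexVertex) : ℂ := (δ : ℂ) * hexCenter y

/-- the slit vertex set: everything off the past except its tip -/
def slitSet (π : List HexVertex) : Set HexVertex := {y | y ∉ π.dropLast}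

/-- vertices of the slit domain in the open annulus `A(x, r, R)` -/
def annVerts (δ : ℝ) (π : List HexVertex) (x : ℂ) (r R : ℝ) : Set HexVertex :=
  {y | y ∈ slitSet π ∧ r < dist (pos δ y) x ∧ dist (pos δ y) x < R}

/-- `C` is a connected component of the annulus part of the slit graph `Ω_δ ∖ π` (Kemppainen–Smirnov
2017, Def. 2.3: the components of `A ∩ U_τ`). -/
def IsAnnulusComponent (Ω : Set ℂ) (δ : ℝ) (π : List HexVertex) (x : ℂ) (r R : ℝ)
    (C : Set HexVertex) : Prop :=
  C ⊆ annVerts δ π x r R ∧ C.Nonempty ∧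
    (∀ y ∈ C, ∀ y' : HexVertex, y' ∈ annVerts δ π x r R → (hexDomainGraph Ω δ).Adj y y' → y' ∈ C) ∧
    ((hexDomainGraph Ω δ).induce C).Preconnected

/-- `C` is UNFORCED (avoidable): the tip is joined to the target `b` in the slit graph avoiding `C`
(KS 2017, Def. 2.3: "does not disconnect"). In a simply connected slit domain an unforced component
leads into a dead end (every cross-cut separates into exactly two components, Pommerenke Prop. 2.12;
triage r1-2 (X2)). -/
def Unforced (Ω : Set ℂ) (δ : ℝ) (π : List HexVertex) (tip b : HexVertex) (C : Set HexVertex) : Prop :=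
  ∃ p : (hexDomainGraph Ω δ).Walk tip b, ∀ y ∈ p.support, y ∈ slitSet π ∧ y ∉ C

/-- KS's non-vacuity condition `∂B(x, r) ∩ ∂U_τ ≠ ∅`, lattice form: some slit-domain vertex within
`r` of `x` has a honeycomb neighbour that is not a slit-domain neighbour (outside `Ω_δ`, on the past,
or across a dropped edge). -/
def InnerTouchesBoundary (Ω : Set ℂ) (δ : ℝ) (π : List HexVertex) (x : ℂ) (r : ℝ) : Prop :=
  ∃ y y' : HexVertex, hexGraph.Adj y y' ∧ dist (pos δ y) x ≤ r ∧
    y ∈ embMeshDomain hexGraph hexCenter Ω δ ∧ y ∈ slitSet π ∧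
    ¬ ((hexDomainGraph Ω δ).Adj y y' ∧ y' ∈ slitSet π)

/-- The vertex list `l` (a whole SAW), read from index `n₀` (the tip) on, makes an INWARD crossing of
`A(x, r, R)` inside `C`: indices `n₀ ≤ i`, `i + 1 < j`, `l[i]` at distance `≥ R`, `l[j]` at distance
`≤ r`, and every vertex strictly between them in `C`. -/
def FutureCrossesIn (l : List HexVertex) (n₀ : ℕ) (C : Set HexVertex) (δ : ℝ) (x : ℂ) (r R : ℝ) : Prop :=
  ∃ i j : ℕ, n₀ ≤ i ∧ i + 1 < j ∧
    (∃ y, l[i]? = some y ∧ R ≤ dist (pos δ y) x) ∧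
    (∃ y, l[j]? = some y ∧ dist (pos δ y) x ≤ r) ∧
    ∀ k, i < k → k < j → ∃ y, l[k]? = some y ∧ y ∈ C

/-- … an OUTWARD crossing of `A(x, r, R)` inside `C` (from distance `≤ r` to distance `≥ R`). -/
def FutureCrossesOut (l : List HexVertex) (n₀ : ℕ) (C : Set HexVertex) (δ : ℝ) (x : ℂ) (r R : ℝ) : Prop :=
  ∃ i j : ℕ, n₀ ≤ i ∧ i + 1 < j ∧
    (∃ y, l[i]? = some y ∧ dist (pos δ y) x ≤ r) ∧
    (∃ y, l[j]? = some y ∧ R ≤ dist (pos δ y) x) ∧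
    ∀ k, i < k → k < j → ∃ y, l[k]? = some y ∧ y ∈ C

/-- **Pinned inward bound = Condition G2 (constant form) for INWARD unforced crossings of the
critical hexagonal SAW, conditionally on any past.** There are a modulus `M > 1` and a lattice
cut-off `r₀ > 0` such that for every bounded `Ω`, mesh `δ > 0`, endpoints `a b`, past `π` (a vertex prefix),
annulus `A(x, r, Mr)` with `r ≥ r₀ δ` whose inner ball touches the slit domain's boundary, and every
UNFORCED annulus component `C`: the `x_c`-weight of the walks `a → b` extending `π` whose future
crosses `C` inward is at most half the weight of all walks extending `π`.
(KS 2017 Condition G2 restricted to hitting-time pasts and split by direction; `1/2` is any constant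
by KS Cor. 2.7.) Pinned at `b`: NOT reachable by the identity alone — see `stub_pinnedReturn_of`. -/
def PinnedReturnBound : Prop :=
  ∃ M r₀ : ℝ, 1 < M ∧ 0 < r₀ ∧ ∀ (Ω : Set ℂ), Bornology.IsBounded Ω → ∀ (δ : ℝ), 0 < δ →
    ∀ (a b : HexVertex) (π : List HexVertex) (hπ : π ≠ []) (x : ℂ) (r : ℝ), r₀ * δ ≤ r →
      InnerTouchesBoundary Ω δ π x r →
      ∀ C : Set HexVertex, IsAnnulusComponent Ω δ π x r (M * r) C →
        Unforced Ω δ π (π.getLast hπ) b C →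
          2 * hexSAWWeight Ω δ a b
              {γ | π <+: γ.walk.support ∧ FutureCrossesIn γ.walk.support (π.length - 1) C δ x r (M * r)} ≤
            hexSAWWeight Ω δ a b {γ | π <+: γ.walk.support}

/-- **Outward dive bound = Condition G2 (constant form) for OUTWARD unforced crossings** (re-ascents
into adjacent, possibly self-made, dead ends). Same quantifiers as `PinnedReturnBound` with
`FutureCrossesOut`. This half of G2 is NOT reachable by the strong-Markov identity (one-way far
enders from a tip are not rare: `Σ_d d^{-15/16}` diverges), and neither half alone yields (H1) (an
arch created by one earlier excursion forces every later return, so an adversary oscillating under it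
pays only for re-ascents; arch-free oscillations pay only for returns). Open, RSW-type, no FKG at
`n = 0`; the shared atom of the lines `reversal-virgin-disc` (`OneScaleDive`, dives INTO virgin
discs) and `domination-buys-tightness`. Size L. -/
def OutwardDiveBound : Prop :=
  ∃ M r₀ : ℝ, 1 < M ∧ 0 < r₀ ∧ ∀ (Ω : Set ℂ), Bornology.IsBounded Ω → ∀ (δ : ℝ), 0 < δ →
    ∀ (a b : HexVertex) (π : List HexVertex) (hπ : π ≠ []) (x : ℂ) (r : ℝ), r₀ * δ ≤ r →
      InnerTouchesBoundary Ω δ π x r →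
      ∀ C : Set HexVertex, IsAnnulusComponent Ω δ π x r (M * r) C →
        Unforced Ω δ π (π.getLast hπ) b C →
          2 * hexSAWWeight Ω δ a b
              {γ | π <+: γ.walk.support ∧ FutureCrossesOut γ.walk.support (π.length - 1) C δ x r (M * r)} ≤
            hexSAWWeight Ω δ a b {γ | π <+: γ.walk.support}


end DSR

/-! ## Part 7 — The weighted ring: `OutwardDiveBound` is false as typed -/

section Outward

open MeasureTheory
open Literature.Probability.RandomPlanarGeometry

variable {K : ℕ}

/-- positions at mesh `1` are the centres -/
@[simp] theorem pos_one (y : HexVertex) : DSR.pos 1 y = hexCenter y := by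
  simp [DSR.pos]

/-- the slit set of a one-cell past is everything -/
@[simp] theorem slitSet_singleton (v : HexVertex) : DSR.slitSet [v] = Set.univ := by
  ext y; simp [DSR.slitSet]

/-- transfer of a lattice walk inside a part of the ring to a walk of `Ω_1` with the same support -/
theorem domWalk_transfer (hK : 1 ≤ K) {S : Set HexVertex} (hS : S ⊆ (ring K : Set HexVertex)) :
    ∀ {u v : HexVertex} (p : hexGraph.Walk u v), (∀ y ∈ p.support, y ∈ S) →
      ∃ q : (hexDomainGraph (Omega K) 1).Walk u v, q.support = p.support
  | _, _, SimpleGraph.Walk.nil, _ => ⟨SimpleGraph.Walk.nil, rfl⟩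
  | a, _, SimpleGraph.Walk.cons (v := b) hab p, hp => by
    have ha : a ∈ S := hp a (by simp)
    have hb : b ∈ S := hp b (List.mem_cons_of_mem _ p.start_mem_support)
    obtain ⟨q, hq⟩ := domWalk_transfer hK hS p fun y hy => hp y (List.mem_cons_of_mem _ hy)
    have hadj : (hexDomainGraph (Omega K) 1).Adj a b :=
      (domAdj_iff hK).2 ⟨hab, Finset.mem_coe.1 (hS ha), Finset.mem_coe.1 (hS hb)⟩
    exact ⟨SimpleGraph.Walk.cons hadj q, by rw [SimpleGraph.Walk.support_cons,
      SimpleGraph.Walk.support_cons, hq]⟩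

/-- the weight of a set of SAWs of `Ω_1`: sum of `x_c^{ℓ(γ)}` over its elements -/
theorem weight_apply {a b : HexVertex} (S : Set (HexDomainSAW (Omega K) 1 a b)) :
    hexSAWWeight (Omega K) 1 a b S =
      ∑ γ, S.indicator (fun γ => ENNReal.ofReal (hexCriticalFugacity ^ γ.vertexCount)) γ := by
  rw [hexSAWWeight, embWeight, Measure.sum_apply _ MeasurableSpace.measurableSet_top, tsum_fintype]
  refine Finset.sum_congr rfl fun γ _ => ?_
  rw [Measure.smul_apply, smul_eq_mul, Measure.dirac_apply' _ MeasurableSpace.measurableSet_top]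
  by_cases hγ : γ ∈ S <;> simp [hγ, Set.indicator]

/-- a walk of the domain graph inside a set lifts to the induced graph on that set -/
theorem induce_reachable {G : SimpleGraph HexVertex} {C : Set HexVertex} :
    ∀ {a b : HexVertex} (p : G.Walk a b) (hp : ∀ z ∈ p.support, z ∈ C),
      (G.induce C).Reachable ⟨a, hp a p.start_mem_support⟩ ⟨b, hp b p.end_mem_support⟩
  | _, _, SimpleGraph.Walk.nil, _ => SimpleGraph.Reachable.refl _
  | _, _, SimpleGraph.Walk.cons (v := b) hab p, hp => by
    have hb : b ∈ C := hp b (List.mem_cons_of_mem _ p.start_mem_support)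
    refine SimpleGraph.Reachable.trans (SimpleGraph.Adj.reachable ?_)
      (induce_reachable p fun z hz => hp z (List.mem_cons_of_mem _ hz))
    simp only [SimpleGraph.comap_adj, Function.Embedding.subtype_apply]
    exact hab

/-- indices of a decomposition `l₁ ++ u :: u' :: l₂ ++ w :: l₃` -/
theorem getElem?_decomp {α : Type*} (l₁ l₂ l₃ : List α) (u u' w : α) :
    (l₁ ++ u :: u' :: l₂ ++ w :: l₃)[l₁.length]? = some u ∧
    (l₁ ++ u :: u' :: l₂ ++ w :: l₃)[l₁.length + (l₂.length + 2)]? = some w ∧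
    ∀ k, l₁.length < k → k < l₁.length + (l₂.length + 2) →
      ∃ y, (l₁ ++ u :: u' :: l₂ ++ w :: l₃)[k]? = some y ∧ y ∈ u' :: l₂ := by
  have hassoc : l₁ ++ u :: u' :: l₂ ++ w :: l₃ = l₁ ++ ((u :: u' :: l₂) ++ (w :: l₃)) := by
    simp [List.append_assoc]
  rw [hassoc]
  refine ⟨?_, ?_, ?_⟩
  · rw [List.getElem?_append_right le_rfl, Nat.sub_self]; rfl
  · rw [List.getElem?_append_right (by omega), Nat.add_sub_cancel_left,
      List.getElem?_append_right (by simp)]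
    simp
  · intro k hk1 hk2
    obtain ⟨k', rfl⟩ : ∃ k', k = l₁.length + (k' + 1) := ⟨k - l₁.length - 1, by omega⟩
    rw [List.getElem?_append_right (by omega), Nat.add_sub_cancel_left,
      List.getElem?_append_left (by simp; omega), List.getElem?_cons_succ]
    have hk' : k' < (u' :: l₂).length := by simp; omega
    exact ⟨(u' :: l₂)[k'], List.getElem?_eq_getElem hk', List.getElem_mem hk'⟩

end Outward


end Summit.CriticalPhenomena.SAWScalingLimit.Cruxes.HexTight.Negative

end
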